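import Summits.QuantumFields.BalabanUV.Beta.GAN24.CapacitanceScalarRateSum
import Summits.QuantumFields.BalabanUV.Beta.GAN24.ReadingWeightRates
import Summits.QuantumFields.BalabanUV.Beta.GAN24.AliasReindex

/-!
# `BalabanUV.Beta.GAN24.SourceSidePair` — binder row G-an2-4 / (CONV-C), road P1-fibre, sub-part **PART S** of gan24-p1's row
# **P1-L11** `FibreRate` (leaf-20-g7's division of L11, CLAIMS l.3039; this seat's TAKE l.3074) — PART 1: the LABEL ENGINE
# (the paired box factor `P_N(Q)`, its two-level rate, and the alias-box majorants)

NOT IN PRINT; OUR PROOF ATTEMPT.  HONEST FRAMING (cell contract, verbatim): «discharging `BetaPertH` makes Bałaban's UV stability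
UNCONDITIONAL — a real constructive-QFT result; it is NOT the continuum limit and NOT the Clay problem.»  HONEST DEPENDENCY (verbatim):
«continuum YM on T⁴ ⇐ BetaPertH ∧ nine spine estimates (0/9 proved); BetaPertH ⇐ (D1) ∧ (D4) ∧ CAP+tail; G-an2-4 gates asym, D1 and
NE2/3/4.»  [folklore] explicit real/complex analysis (geometric sums, Jordan, `sin` Taylor); 0 cite, 0 wall binder, no `def … : Prop`;
two harmless real/complex-valued `def`s (`tsq`, `pairP`).  It discharges NOTHING of (CONV-C)'s K-slot `GAN24.CombesThomas.ConvCK 3 Lc`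
by itself — it is Part-B (rate `θ = Lc⁻²`) bookkeeping for the SOURCE-SIDE feed sums `S_φ = AliasObjects.srcPhi N p (fhatF N M p l y′) 0`,
`S_c = AliasObjects.srcC N p (fhatF N M p l y′)` of the closed-form fibre function, consumed by gan24-p1's row P1-L11 `FibreRate` through
leaf-20-g7's «capacitance side + products + units + composition».  NOT `BetaPertH`, NOT continuum, NOT Clay.  Value = kernel bookkeeping
toward the K-slot route P1 of binder row G-an2-4, NOT summit progress.

## The structure (SKELETON-P1 S1b′/S1c + B1; derived for PART S)
At a real coarse momentum `p = ofRealVec q`, `q ∈ [−π, π]^D ∖ {0}`, block side `N`, decimation side `M`, `N = M·Lc`, every summand of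
`S_φ`, `S_c` is a function of the ZONE LABEL `Q = q + 2π·z` (`z = zvec N q m`, `|Q_i| ≤ πN`, leaf P1-Y11s `CapacitanceScalarRateTerm`) built
from:
* the **paired box factor** `pairP N M Q_i := gs(Q_i/N, N)·gs(−Q_i/N, M)/(N·M)` — the box weight `s_i(m)` of `S(m)` paired with the
  REFLECTED `M`-level factor `s♭_{M,i}(m)` of the source weight `srcW`.  Its phase is `e^{iQ_i(1 − 1/Lc)/2}`, LEVEL-FREE (B1: «the
  first-order terms are pure phases that cancel»), and its modulus is `Lc·|sin(Q_i/2)·sin(Q_i/(2Lc))|·4/tsq N Q_i` with the one-coordinate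
  scaled symbol `tsq N Q = (2N sin(Q/(2N)))²` — so the ONLY `N`-dependence is through `1/tsq`, whose two-level rate is `(π²/24)/N²`
  (`pairP_closed`, `norm_pairP_sub_le`: `‖P_{N′} − P_N‖ ≤ (π²/6)·Lc·|sin(Q/2) sin(Q/2Lc)|/N²`, hence `≤ (π²/6)Lc/N²` and, near the zero
  alias, `≤ (π²/24)·Q²/N²` — the `Q²` that cancels the `1/|q|²` pole of the zero alias);
* the label-free / level-free telescoped factors `s_{l′}(m)·∂_{m,l′} = e^{iq_{l′}} − 1` and `s♭_{M,l}(m)·∂♭_{m,l} = e^{−iQ_l/Lc} − 1`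
  (part 2, `SourceSideDict`);
* the scaled inverse Laplacian symbol `CapacitanceScalarRate.symN` (leaf P1-Y11s) BY NAME.
This part proves the one-coordinate facts (`tsq`, `pairP`: closed form, modulus, decay `π²Lc/Q²`, two-level rate); the ALIAS-BOX MAJORANTS
(`mP`, `Σ_{z ∈ boxZ N q} Π_i mP Lc z_i ≤ (1 + 4Lc)^D`, direction-wise decay, complex product telescoping) are the companion module
`GAN24/SourceSideMajorant` (same sub-part, same seat).

Unit `b2b-balaban-gan24-formalise-leaf-07` (G-an2-4 formalisation swarm, leaf prover 07, gen 6), 2026-08-20.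
-/

noncomputable section

open Complex Finset
open scoped BigOperators Real

namespace Summit.QuantumFields.BalabanUV.Beta.GAN24.SourceSidePair

open AliasWeights AliasWeightsClosedForm SymbolTaylor CapacitanceScalarRate CapacitanceScalarRateTerm
  CapacitanceScalarRateBox CapacitanceScalarRateSum ReadingWeightRates
open AliasObjects (gs)
open Literature.MathematicalPhysics.QuantumFieldTheory.King1986 (momSq momSq_nonneg)

variable {D : ℕ}

/-! ## §1 The one-coordinate scaled symbol `tsq N Q = N²·4 sin²(Q/(2N)) = (2N sin(Q/(2N)))²` -/

/-- The one-coordinate SCALED Laplacian symbol `tsq N Q = N²·4 sin²(Q/(2N))` (`→ Q²`; the `D = 1` case of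
`CapacitanceScalarRate.symN`). -/
def tsq (N : ℕ) (Q : ℝ) : ℝ := (N : ℝ) ^ 2 * (4 * Real.sin (Q / (2 * N)) ^ 2)

/-- [folklore] `0 ≤ tsq N Q`. -/
theorem tsq_nonneg (N : ℕ) (Q : ℝ) : 0 ≤ tsq N Q := by unfold tsq; positivity

/-- [folklore] `tsq N Q ≤ Q²` (leaf P1-L07 `sq_mul_four_sin_sq_le_sq` BY NAME). -/
theorem tsq_le_sq {N : ℕ} (hN : 0 < N) (Q : ℝ) : tsq N Q ≤ Q ^ 2 := by
  have hNr : (N : ℝ) ≠ 0 := by exact_mod_cast hN.ne'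
  exact sq_mul_four_sin_sq_le_sq hNr Q

/-- [folklore] Jordan: `(4/π²)·Q² ≤ tsq N Q` on the zone `|Q| ≤ πN` (leaf P1-L07 `jordan_sq_mul_four_sin_sq` BY NAME). -/
theorem jordan_tsq {N : ℕ} (hN : 0 < N) {Q : ℝ} (hQ : |Q| ≤ π * N) : 4 / π ^ 2 * Q ^ 2 ≤ tsq N Q := by
  have hNr : (0 : ℝ) < N := by exact_mod_cast hN
  exact jordan_sq_mul_four_sin_sq hNr hQ

/-- [folklore] `0 < tsq N Q` for `Q ≠ 0` on the zone. -/
theorem tsq_pos {N : ℕ} (hN : 0 < N) {Q : ℝ} (hQ : |Q| ≤ π * N) (hQ0 : Q ≠ 0) : 0 < tsq N Q :=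
  lt_of_lt_of_le (by positivity) (jordan_tsq hN hQ)

/-- [folklore] `4/tsq N Q ≤ π²/Q²` for `Q ≠ 0` on the zone. -/
theorem four_div_tsq_le {N : ℕ} (hN : 0 < N) {Q : ℝ} (hQ : |Q| ≤ π * N) (hQ0 : Q ≠ 0) :
    4 / tsq N Q ≤ π ^ 2 / Q ^ 2 := by
  have hj := jordan_tsq hN hQ
  have ht := tsq_pos hN hQ hQ0
  have hQ2 : 0 < Q ^ 2 := by positivity
  rw [div_le_div_iff₀ ht hQ2]
  have hπ := Real.pi_pos
  calc 4 * Q ^ 2 = π ^ 2 * (4 / π ^ 2 * Q ^ 2) := by field_simp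
    _ ≤ π ^ 2 * tsq N Q := mul_le_mul_of_nonneg_left hj (by positivity)

/-- [folklore] INVERSE SYMBOL RATE, one coordinate: `|1/tsq N Q − 1/Q²| ≤ (π²/48)/N²` for `Q ≠ 0` on the zone
(`|tsq − Q²| ≤ Q⁴/(12N²)` of leaf P1-L07 over the Jordan lower bound; King 1986 (4.7)-type). -/
theorem abs_inv_tsq_sub_inv_sq_le {N : ℕ} (hN : 0 < N) {Q : ℝ} (hQ : |Q| ≤ π * N) (hQ0 : Q ≠ 0) :
    |(tsq N Q)⁻¹ - (Q ^ 2)⁻¹| ≤ π ^ 2 / 48 / (N : ℝ) ^ 2 := by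
  have hNr : (0 : ℝ) < N := by exact_mod_cast hN
  have ht := tsq_pos hN hQ hQ0
  have hQ2 : 0 < Q ^ 2 := by positivity
  have hj := jordan_tsq hN hQ
  have htay : |tsq N Q - Q ^ 2| ≤ Q ^ 4 / (12 * (N : ℝ) ^ 2) := abs_sq_mul_four_sin_sq_sub_sq_le hNr.ne' Q
  have hπ := Real.pi_pos
  rw [inv_sub_inv ht.ne' hQ2.ne', abs_div, abs_of_pos (mul_pos ht hQ2), abs_sub_comm]
  rw [div_le_iff₀ (mul_pos ht hQ2)]
  calc |tsq N Q - Q ^ 2| ≤ Q ^ 4 / (12 * (N : ℝ) ^ 2) := htay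
    _ = π ^ 2 / 48 / (N : ℝ) ^ 2 * ((4 / π ^ 2 * Q ^ 2) * Q ^ 2) := by field_simp; ring
    _ ≤ π ^ 2 / 48 / (N : ℝ) ^ 2 * (tsq N Q * Q ^ 2) := by
        apply mul_le_mul_of_nonneg_left _ (by positivity)
        exact mul_le_mul_of_nonneg_right hj hQ2.le

/-- [folklore] TWO-LEVEL inverse symbol rate, one coordinate: `|1/tsq N′ Q − 1/tsq N Q| ≤ (π²/24)/N²` for `N ≤ N′`, `Q ≠ 0` in the
level-`N` zone. -/
theorem abs_inv_tsq_sub_inv_tsq_le {N N' : ℕ} (hN : 0 < N) (hNN' : N ≤ N') {Q : ℝ} (hQ : |Q| ≤ π * N) (hQ0 : Q ≠ 0) :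
    |(tsq N' Q)⁻¹ - (tsq N Q)⁻¹| ≤ π ^ 2 / 24 / (N : ℝ) ^ 2 := by
  have hN' : 0 < N' := lt_of_lt_of_le hN hNN'
  have hNr : (0 : ℝ) < N := by exact_mod_cast hN
  have hNN'r : (N : ℝ) ≤ N' := by exact_mod_cast hNN'
  have hQ' : |Q| ≤ π * N' := hQ.trans (by nlinarith [Real.pi_pos])
  have h1 := abs_inv_tsq_sub_inv_sq_le hN hQ hQ0
  have h2 := abs_inv_tsq_sub_inv_sq_le hN' hQ' hQ0
  have hmono : π ^ 2 / 48 / (N' : ℝ) ^ 2 ≤ π ^ 2 / 48 / (N : ℝ) ^ 2 :=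
    div_le_div_of_nonneg_left (by positivity) (by positivity) (pow_le_pow_left₀ hNr.le hNN'r 2)
  calc |(tsq N' Q)⁻¹ - (tsq N Q)⁻¹|
      ≤ |(tsq N' Q)⁻¹ - (Q ^ 2)⁻¹| + |(Q ^ 2)⁻¹ - (tsq N Q)⁻¹| := abs_sub_le _ _ _
    _ ≤ π ^ 2 / 48 / (N : ℝ) ^ 2 + π ^ 2 / 48 / (N : ℝ) ^ 2 := by
        refine add_le_add (h2.trans hmono) ?_
        rw [abs_sub_comm]; exact h1
    _ = π ^ 2 / 24 / (N : ℝ) ^ 2 := by ring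

/-! ## §2 The paired box factor `pairP N M Q = gs(Q/N, N)·gs(−Q/N, M)/(N·M)` -/

/-- THE PAIRED BOX FACTOR of one coordinate at the label `Q` (fine momentum `Q/N`): the box weight `s = Σ_{t<N} e^{i(Q/N)t}` paired
with the reflected decimation-level weight `s♭_M = Σ_{t<M} e^{−i(Q/N)t}`, normalised by `N·M`. -/
def pairP (N M : ℕ) (Q : ℝ) : ℂ := gs ((Q / N : ℝ) : ℂ) N * gs (-((Q / N : ℝ) : ℂ)) M / ((N : ℂ) * (M : ℂ))

/-- [folklore] `gs 0 n = n`. -/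
theorem gs_zero (n : ℕ) : gs 0 n = n := by
  unfold gs; simp

/-- [folklore] At the label `Q = 0` the paired factor is `1`. -/
theorem pairP_zero {N M : ℕ} (hN : 0 < N) (hM : 0 < M) : pairP N M 0 = 1 := by
  have hNc : (N : ℂ) ≠ 0 := by exact_mod_cast hN.ne'
  have hMc : (M : ℂ) ≠ 0 := by exact_mod_cast hM.ne'
  unfold pairP
  rw [zero_div, Complex.ofReal_zero, neg_zero, gs_zero, gs_zero]
  field_simp

/-- [folklore] The reflected geometric sum is the geometric sum at the reflected (real) argument. -/
theorem gs_neg_ofReal (x : ℝ) (n : ℕ) : gs (-(x : ℂ)) n = ∑ t ∈ Finset.range n, cexp (I * ((-x : ℝ) : ℂ) * t) := by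
  rw [Complex.ofReal_neg]; rfl

/-- [folklore] `‖pairP N M Q‖ ≤ 1` (each geometric sum is bounded by its number of terms). -/
theorem norm_pairP_le_one {N M : ℕ} (hN : 0 < N) (hM : 0 < M) (Q : ℝ) : ‖pairP N M Q‖ ≤ 1 := by
  have hNr : (0 : ℝ) < N := by exact_mod_cast hN
  have hMr : (0 : ℝ) < M := by exact_mod_cast hM
  have h1 : ‖gs ((Q / N : ℝ) : ℂ) N‖ ≤ N := norm_geomExp_le (Q / N) N
  have h2 : ‖gs (-((Q / N : ℝ) : ℂ)) M‖ ≤ M := by rw [gs_neg_ofReal]; exact norm_geomExp_le _ M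
  unfold pairP
  rw [norm_div, norm_mul, norm_mul, Complex.norm_natCast, Complex.norm_natCast, div_le_one (by positivity)]
  exact mul_le_mul h1 h2 (norm_nonneg _) hNr.le

/-- [folklore] **CLOSED FORM OF THE PAIRED FACTOR** (general levels): for `sin(Q/(2N)) ≠ 0`,
`pairP N M Q = e^{i(N−M)(Q/N)/2} · sin(Q/2)·sin(M(Q/N)/2)/(N·M·sin²(Q/(2N)))` — the phase/modulus factorisation
`ReadingWeightRates.geomExp_eq_phase_mul` BY NAME at `x = Q/N` for both factors. -/
theorem pairP_eq_phase_mul {N M : ℕ} (hN : 0 < N) (hM : 0 < M) {Q : ℝ} (hsin : Real.sin (Q / N / 2) ≠ 0) :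
    pairP N M Q = cexp (I * ((((N : ℝ) - M) * (Q / N) / 2 : ℝ) : ℂ)) *
      ((Real.sin (Q / 2) * Real.sin (M * (Q / N) / 2) / (N * M * Real.sin (Q / N / 2) ^ 2) : ℝ) : ℂ) := by
  have hNr : (N : ℝ) ≠ 0 := by exact_mod_cast hN.ne'
  have hMr : (M : ℝ) ≠ 0 := by exact_mod_cast hM.ne'
  have hsin' : Real.sin (-(Q / N) / 2) ≠ 0 := by
    rw [show -(Q / N) / 2 = -(Q / N / 2) by ring, Real.sin_neg]; exact neg_ne_zero.2 hsin
  have h1 : gs ((Q / N : ℝ) : ℂ) N = cexp (I * ((((N : ℝ) - 1) * (Q / N) / 2 : ℝ) : ℂ)) *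
      ((Real.sin (N * (Q / N) / 2) / Real.sin (Q / N / 2) : ℝ) : ℂ) := geomExp_eq_phase_mul (Q / N) N hsin
  have h2 : gs (-((Q / N : ℝ) : ℂ)) M = cexp (I * ((((M : ℝ) - 1) * (-(Q / N)) / 2 : ℝ) : ℂ)) *
      ((Real.sin (M * (-(Q / N)) / 2) / Real.sin (-(Q / N) / 2) : ℝ) : ℂ) := by
    rw [gs_neg_ofReal]; exact geomExp_eq_phase_mul (-(Q / N)) M hsin'
  have hNQ : (N : ℝ) * (Q / N) / 2 = Q / 2 := by field_simp
  have hr2 : Real.sin (M * (-(Q / N)) / 2) / Real.sin (-(Q / N) / 2) = Real.sin (M * (Q / N) / 2) / Real.sin (Q / N / 2) := by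
    rw [show (M : ℝ) * (-(Q / N)) / 2 = -(M * (Q / N) / 2) by ring, show -(Q / N) / 2 = -(Q / N / 2) by ring,
      Real.sin_neg, Real.sin_neg, neg_div_neg_eq]
  rw [hNQ] at h1
  rw [hr2] at h2
  unfold pairP
  rw [h1, h2]
  have hNc : (N : ℂ) ≠ 0 := by exact_mod_cast hN.ne'
  have hMc : (M : ℂ) ≠ 0 := by exact_mod_cast hM.ne'
  have hsc : ((Real.sin (Q / N / 2) : ℝ) : ℂ) ≠ 0 := by exact_mod_cast hsin
  have hexp : cexp (I * ((((N : ℝ) - 1) * (Q / N) / 2 : ℝ) : ℂ)) * cexp (I * ((((M : ℝ) - 1) * (-(Q / N)) / 2 : ℝ) : ℂ))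
      = cexp (I * ((((N : ℝ) - M) * (Q / N) / 2 : ℝ) : ℂ)) := by
    rw [← Complex.exp_add]; congr 1; push_cast; ring
  calc cexp (I * ((((N : ℝ) - 1) * (Q / N) / 2 : ℝ) : ℂ)) * ((Real.sin (Q / 2) / Real.sin (Q / N / 2) : ℝ) : ℂ) *
        (cexp (I * ((((M : ℝ) - 1) * (-(Q / N)) / 2 : ℝ) : ℂ)) *
          ((Real.sin (M * (Q / N) / 2) / Real.sin (Q / N / 2) : ℝ) : ℂ)) / ((N : ℂ) * (M : ℂ))
      = (cexp (I * ((((N : ℝ) - 1) * (Q / N) / 2 : ℝ) : ℂ)) * cexp (I * ((((M : ℝ) - 1) * (-(Q / N)) / 2 : ℝ) : ℂ))) *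
          (((Real.sin (Q / 2) / Real.sin (Q / N / 2) : ℝ) : ℂ) * ((Real.sin (M * (Q / N) / 2) / Real.sin (Q / N / 2) : ℝ) : ℂ) /
            ((N : ℂ) * (M : ℂ))) := by ring
    _ = _ := by
        rw [hexp]
        congr 1
        push_cast
        field_simp

/-- [folklore] **CLOSED FORM AT A STEP** (`N = M·Lc`): `pairP N M Q = e^{i(1 − 1/Lc)Q/2} · (Lc·sin(Q/2)·sin(Q/(2Lc))·(4/tsq N Q))` for
`Q ≠ 0` in the zone `|Q| ≤ πN` — a LEVEL-FREE unimodular phase times a real number whose only `N`-dependence is `1/tsq N Q`. -/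
theorem pairP_closed {N M Lc : ℕ} (hN : 0 < N) (hM : 0 < M) (hLc : 0 < Lc) (hNM : (N : ℝ) = M * Lc) {Q : ℝ}
    (hQ : |Q| ≤ π * N) (hQ0 : Q ≠ 0) :
    pairP N M Q = cexp (I * (((1 - 1 / (Lc : ℝ)) * Q / 2 : ℝ) : ℂ)) *
      (((Lc : ℝ) * (Real.sin (Q / 2) * Real.sin (Q / (2 * Lc))) * (4 / tsq N Q) : ℝ) : ℂ) := by
  have hNr : (0 : ℝ) < N := by exact_mod_cast hN
  have hMr : (0 : ℝ) < M := by exact_mod_cast hM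
  have hLcr : (0 : ℝ) < Lc := by exact_mod_cast hLc
  have hπ := Real.pi_pos
  -- `sin(Q/(2N)) ≠ 0` on the punctured zone
  have ht : |Q / N / 2| ≤ π / 2 := by
    rw [abs_div, abs_div, abs_of_pos hNr, abs_two, div_div, div_le_iff₀ (by positivity)]; nlinarith
  have ht0 : Q / N / 2 ≠ 0 := by positivity
  have hsin : Real.sin (Q / N / 2) ≠ 0 := by
    intro h0
    have h1 : -π < Q / N / 2 := by have := (abs_le.1 ht).1; linarith
    have h2 : Q / N / 2 < π := by have := (abs_le.1 ht).2; linarith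
    exact ht0 ((Real.sin_eq_zero_iff_of_lt_of_lt h1 h2).1 h0)
  rw [pairP_eq_phase_mul hN hM hsin]
  have hph : ((N : ℝ) - M) * (Q / N) / 2 = (1 - 1 / (Lc : ℝ)) * Q / 2 := by
    rw [hNM]; field_simp
  have hMQ : (M : ℝ) * (Q / N) / 2 = Q / (2 * Lc) := by rw [hNM]; field_simp
  have hre : Real.sin (Q / 2) * Real.sin (M * (Q / N) / 2) / (N * M * Real.sin (Q / N / 2) ^ 2)
      = (Lc : ℝ) * (Real.sin (Q / 2) * Real.sin (Q / (2 * Lc))) * (4 / tsq N Q) := by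
    rw [hMQ]
    unfold tsq
    have hM' : (M : ℝ) = N / Lc := by rw [hNM]; field_simp
    rw [hM', show Q / N / 2 = Q / (2 * N) by ring]
    field_simp
  rw [hph, hre]

/-- [folklore] **MODULUS OF THE PAIRED FACTOR** at a step: `‖pairP N M Q‖ = Lc·|sin(Q/2)·sin(Q/(2Lc))|·(4/tsq N Q)` (`Q ≠ 0`, zone). -/
theorem norm_pairP_eq {N M Lc : ℕ} (hN : 0 < N) (hM : 0 < M) (hLc : 0 < Lc) (hNM : (N : ℝ) = M * Lc) {Q : ℝ}
    (hQ : |Q| ≤ π * N) (hQ0 : Q ≠ 0) :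
    ‖pairP N M Q‖ = (Lc : ℝ) * |Real.sin (Q / 2) * Real.sin (Q / (2 * Lc))| * (4 / tsq N Q) := by
  have hLcr : (0 : ℝ) < Lc := by exact_mod_cast hLc
  have ht : 0 < 4 / tsq N Q := div_pos (by norm_num) (tsq_pos hN hQ hQ0)
  rw [pairP_closed hN hM hLc hNM hQ hQ0, norm_mul, Complex.norm_exp_I_mul_ofReal, one_mul, Complex.norm_real,
    Real.norm_eq_abs, abs_mul, abs_mul, abs_of_pos hLcr, abs_of_pos ht]

/-- [folklore] `Lc·|sin(Q/2)·sin(Q/(2Lc))| ≤ Lc`. -/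
theorem sinProd_le_Lc {Lc : ℕ} (Q : ℝ) : (Lc : ℝ) * |Real.sin (Q / 2) * Real.sin (Q / (2 * Lc))| ≤ Lc := by
  have h : |Real.sin (Q / 2) * Real.sin (Q / (2 * Lc))| ≤ 1 := by
    rw [abs_mul]
    exact mul_le_one₀ (Real.abs_sin_le_one _) (abs_nonneg _) (Real.abs_sin_le_one _)
  calc (Lc : ℝ) * |Real.sin (Q / 2) * Real.sin (Q / (2 * Lc))| ≤ Lc * 1 := mul_le_mul_of_nonneg_left h (Nat.cast_nonneg Lc)
    _ = Lc := mul_one _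

/-- [folklore] `Lc·|sin(Q/2)·sin(Q/(2Lc))| ≤ Q²/4` (`|sin x| ≤ |x|` twice; the `Q²` that cancels the zero-alias pole). -/
theorem sinProd_le_sq {Lc : ℕ} (hLc : 0 < Lc) (Q : ℝ) : (Lc : ℝ) * |Real.sin (Q / 2) * Real.sin (Q / (2 * Lc))| ≤ Q ^ 2 / 4 := by
  have hLcr : (0 : ℝ) < Lc := by exact_mod_cast hLc
  have h1 : |Real.sin (Q / 2)| ≤ |Q| / 2 := by
    have := Real.abs_sin_le_abs (x := Q / 2); rwa [abs_div, abs_two] at this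
  have h2 : |Real.sin (Q / (2 * Lc))| ≤ |Q| / (2 * Lc) := by
    have := Real.abs_sin_le_abs (x := Q / (2 * Lc))
    rwa [abs_div, abs_mul, abs_two, abs_of_pos hLcr] at this
  rw [abs_mul]
  calc (Lc : ℝ) * (|Real.sin (Q / 2)| * |Real.sin (Q / (2 * Lc))|) ≤ Lc * (|Q| / 2 * (|Q| / (2 * Lc))) :=
        mul_le_mul_of_nonneg_left (mul_le_mul h1 h2 (abs_nonneg _) (by positivity)) hLcr.le
    _ = Q ^ 2 / 4 := by field_simp; rw [sq_abs]; ring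

/-- [folklore] **DECAY OF THE PAIRED FACTOR**: `‖pairP N M Q‖ ≤ π²·Lc/Q²` for `Q ≠ 0` in the zone. -/
theorem norm_pairP_le_div_sq {N M Lc : ℕ} (hN : 0 < N) (hM : 0 < M) (hLc : 0 < Lc) (hNM : (N : ℝ) = M * Lc) {Q : ℝ}
    (hQ : |Q| ≤ π * N) (hQ0 : Q ≠ 0) : ‖pairP N M Q‖ ≤ π ^ 2 * Lc / Q ^ 2 := by
  rw [norm_pairP_eq hN hM hLc hNM hQ hQ0]
  have h1 := sinProd_le_Lc (Lc := Lc) Q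
  have h2 := four_div_tsq_le hN hQ hQ0
  have ht : 0 ≤ 4 / tsq N Q := div_nonneg (by norm_num) (tsq_nonneg N Q)
  calc (Lc : ℝ) * |Real.sin (Q / 2) * Real.sin (Q / (2 * Lc))| * (4 / tsq N Q) ≤ Lc * (π ^ 2 / Q ^ 2) :=
        mul_le_mul h1 h2 ht (Nat.cast_nonneg Lc)
    _ = π ^ 2 * Lc / Q ^ 2 := by ring

/-- [folklore] **TWO-LEVEL RATE OF THE PAIRED FACTOR** (the `O(Lc^{−2(j+1)})` termwise rate of PART S): for two steps
`N = M·Lc ≤ N′ = M′·Lc` (same `Lc`) and a label of the level-`N` zone, `‖pairP N′ M′ Q − pairP N M Q‖ ≤ (π²/6)·Lc·|sin(Q/2) sin(Q/(2Lc))|/N²`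
— the phase and the factor `Lc·sin·sin` are level-free, only `1/tsq` moves, by `(π²/24)/N²`. -/
theorem norm_pairP_sub_le {N M N' M' Lc : ℕ} (hN : 0 < N) (hM : 0 < M) (hN' : 0 < N') (hM' : 0 < M') (hLc : 0 < Lc)
    (hNM : (N : ℝ) = M * Lc) (hN'M' : (N' : ℝ) = M' * Lc) (hNN' : N ≤ N') {Q : ℝ} (hQ : |Q| ≤ π * N) :
    ‖pairP N' M' Q - pairP N M Q‖ ≤ π ^ 2 / 6 * ((Lc : ℝ) * |Real.sin (Q / 2) * Real.sin (Q / (2 * Lc))|) / (N : ℝ) ^ 2 := by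
  rcases eq_or_ne Q 0 with hQ0 | hQ0
  · subst hQ0
    rw [pairP_zero hN hM, pairP_zero hN' hM', sub_self, norm_zero]
    positivity
  have hNr : (0 : ℝ) < N := by exact_mod_cast hN
  have hNN'r : (N : ℝ) ≤ N' := by exact_mod_cast hNN'
  have hQ' : |Q| ≤ π * N' := hQ.trans (by nlinarith [Real.pi_pos])
  have hLcr : (0 : ℝ) < Lc := by exact_mod_cast hLc
  rw [pairP_closed hN' hM' hLc hN'M' hQ' hQ0, pairP_closed hN hM hLc hNM hQ hQ0, ← mul_sub, norm_mul,
    Complex.norm_exp_I_mul_ofReal, one_mul, ← Complex.ofReal_sub, Complex.norm_real, Real.norm_eq_abs, ← mul_sub, abs_mul,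
    abs_mul, abs_of_pos hLcr]
  have hrate : |4 / tsq N' Q - 4 / tsq N Q| ≤ π ^ 2 / 6 / (N : ℝ) ^ 2 := by
    rw [div_eq_mul_inv, div_eq_mul_inv, ← mul_sub, abs_mul, abs_of_pos (by norm_num : (0 : ℝ) < 4)]
    calc 4 * |(tsq N' Q)⁻¹ - (tsq N Q)⁻¹| ≤ 4 * (π ^ 2 / 24 / (N : ℝ) ^ 2) :=
          mul_le_mul_of_nonneg_left (abs_inv_tsq_sub_inv_tsq_le hN hNN' hQ hQ0) (by norm_num)
      _ = π ^ 2 / 6 / (N : ℝ) ^ 2 := by ring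
  calc (Lc : ℝ) * |Real.sin (Q / 2) * Real.sin (Q / (2 * Lc))| * |4 / tsq N' Q - 4 / tsq N Q|
      ≤ (Lc : ℝ) * |Real.sin (Q / 2) * Real.sin (Q / (2 * Lc))| * (π ^ 2 / 6 / (N : ℝ) ^ 2) :=
        mul_le_mul_of_nonneg_left hrate (by positivity)
    _ = _ := by ring

/-- [folklore] Label-uniform form of the two-level rate: `≤ (π²/6)·Lc/N²`. -/
theorem norm_pairP_sub_le_unif {N M N' M' Lc : ℕ} (hN : 0 < N) (hM : 0 < M) (hN' : 0 < N') (hM' : 0 < M') (hLc : 0 < Lc)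
    (hNM : (N : ℝ) = M * Lc) (hN'M' : (N' : ℝ) = M' * Lc) (hNN' : N ≤ N') {Q : ℝ} (hQ : |Q| ≤ π * N) :
    ‖pairP N' M' Q - pairP N M Q‖ ≤ π ^ 2 / 6 * Lc / (N : ℝ) ^ 2 := by
  refine (norm_pairP_sub_le hN hM hN' hM' hLc hNM hN'M' hNN' hQ).trans ?_
  have h := sinProd_le_Lc (Lc := Lc) Q
  have hπ := Real.pi_pos
  rw [div_le_div_iff_of_pos_right (by positivity)]
  exact mul_le_mul_of_nonneg_left h (by positivity)

/-- [folklore] Zero-alias form of the two-level rate: `≤ (π²/24)·Q²/N²`. -/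
theorem norm_pairP_sub_le_sq {N M N' M' Lc : ℕ} (hN : 0 < N) (hM : 0 < M) (hN' : 0 < N') (hM' : 0 < M') (hLc : 0 < Lc)
    (hNM : (N : ℝ) = M * Lc) (hN'M' : (N' : ℝ) = M' * Lc) (hNN' : N ≤ N') {Q : ℝ} (hQ : |Q| ≤ π * N) :
    ‖pairP N' M' Q - pairP N M Q‖ ≤ π ^ 2 / 24 * Q ^ 2 / (N : ℝ) ^ 2 := by
  refine (norm_pairP_sub_le hN hM hN' hM' hLc hNM hN'M' hNN' hQ).trans ?_
  have h := sinProd_le_sq hLc Q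
  have hπ := Real.pi_pos
  rw [div_le_div_iff_of_pos_right (by positivity)]
  calc π ^ 2 / 6 * ((Lc : ℝ) * |Real.sin (Q / 2) * Real.sin (Q / (2 * Lc))|) ≤ π ^ 2 / 6 * (Q ^ 2 / 4) :=
        mul_le_mul_of_nonneg_left h (by positivity)
    _ = π ^ 2 / 24 * Q ^ 2 := by ring

end Summit.QuantumFields.BalabanUV.Beta.GAN24.SourceSidePair

end
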